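import Mathlib
import HarnessLib
import Summits.AtomisticToContinuum.FouriersLaw.Theses.StaticAbelianSqueeze
import Summits.AtomisticToContinuum.FouriersLaw.Theses.EmbeddedDrudeMourre
import Summits.AtomisticToContinuum.FouriersLaw.Theses.LatticeLandauDamping
import Summits.AtomisticToContinuum.FouriersLaw.Theorems.StaticAbelianSqueezeUniformAbelianRegularityOfAbelSummableSplice
import Summits.AtomisticToContinuum.FouriersLaw.Theorems.StaticAbelianSqueezeUniformAbelianRegularityOfQuasiAdditivity
import Summits.AtomisticToContinuum.FouriersLaw.Theorems.StaticAbelianSqueezeUniformAbelianRegularityFixedNAbelRegularity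
import Summits.AtomisticToContinuum.FouriersLaw.Theorems.StaticAbelianSqueezeUniformAbelianRegularityGlueContactSplice
import Summits.AtomisticToContinuum.FouriersLaw.Theorems.StaticAbelianSqueezeUniformAbelianRegularityGlueTruncatedGK
import Summits.AtomisticToContinuum.FouriersLaw.Theorems.StaticAbelianSqueezeUniformAbelianRegularityTailsOfTruncatedGK
import Summits.AtomisticToContinuum.FouriersLaw.Theorems.StaticAbelianSqueezeUniformAbelianRegularityBulkAbelOfItems
import Summits.AtomisticToContinuum.FouriersLaw.Theorems.StaticAbelianSqueezeUniformAbelianRegularityGlueTGKSplit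

/-!
# Skeleton of line `Sketch` (crux idea `zero-mean-dyadic-splice`) for the crux
`StaticAbelianSqueeze.UniformAbelianRegularity` = (R), item stmt-AtomisticToContinuum-13416
(lead prover-line-stmt-AtomisticToContinuum-13416-c1-0, continuation lead c1, 2026-08-17)

Rev 6.  Every glue and every analysis stub of the line is LANDED (this session: p163177, p163652, p163567, p163862, p164462,
p164485, p165030, p166843, p166874; earlier p149168, p151063, p151851, p152607, p153215).  The skeleton consists of FOUR
compositions concluding the crux BY NAME, open exactly through the `sorryAx` of SIX registered PHYSICAL stubs (all open-problem
class — no tree engine reaches times `≍ N`; every landed matching engine has an `N`-independent horizon):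

  (A)  (R) ⇐ M1 `stub_contactSplice` ∧ M2 `stub_bulkAbelRegularPair` ∧ K1 `stub_postCrossingTails`
       [glues p164462 (M1 ∧ M2 ⟹ Abel-summable splice, `C := D.currentCorrelation μT`) → p163652 ((splice ∧ K1 ⟹ (R)); K4 of rev 3 gone];
  (A') (R) ⇐ M1 ∧ K1 ∧ the EXISTING ITEMS `LatticeLandauDamping.WindowDecomposition` (stmt-14011) ∧ `NoDrudeWeight` (stmt-14012)
       [glue p166843 `stub_bulkAbelRegularPairOfWindow`: M2 from the two items with NO witness seam (their witness is shift-invariant;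
       all regular pairs share `C_T` by `currentCorrelation_eq_of_isShiftInvariant` — DLR uniqueness + flow rigidity); also
       `stub_bulkAbelRegularPairOfAbelGreenKubo`: M2 ⇐ `AbelGreenKubo` (stmt-14010) ∧ SI] — stated below as a CONDITIONAL theorem
       (the items are not stubs of this crux);
  (B)  (R) ⇐ TGK3 `stub_truncatedGKQuasiAdditive` alone [p164485 → p163567, with the landed fixed-`N` regularity p163862];
  (B') (R) ⇐ EARLY3 `stub_early3Cancellation` ∧ TAILSRATE `stub_postCrossingTailsRate` [p166874 → (B)].
Order among the physical statements (landed): TGK3 ⟹ K1 (p165030); ST (twin cut) ⟹ K1 (p153215); TAILSRATE ⟹ K1 (trivially, rate ⟹ ε);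
(R) ⟹ M2 for some regular pair (`bulkAbel_of_regularity`, p164462; so M2 is (R)-NECESSARY).

Wave-4 findings not registered as stubs (published as `Lines/Sketch_aux_M1_*.lean`): M1 ⇐ K3 (two-length EXPONENTIAL linear light
cone for anchored current sums + linear-cone bulk identification) ∧ K2′ (Cesàro decay of the contact layer), 691 lines sorry-free;
and the verdict that even the FIXED-horizon `O(1)` splice is not derivable from landed engines (needs one depth-summable matching
lemma L_fix; the landed ones are rate-free or have non-summable rates).

Crux (FIXED, concluded BY NAME below). For `pinnedChain ω₂ lam β γ` (all `> 0`), `T > 0`, `J = Σ_i bondCurrent N i`,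
`μ_N = gibbsMeasure N T`, `P_t = transitionKernel N T T t` and `c_N(t) = ∫ J · (P_t J) dμ_N`:
`∀ ε > 0 ∃ ν₀ > 0 ∀ ν ∈ (0, ν₀)`, eventually in `N`, `|∫₀^∞ (1 − e^{−νt}) c_N(t) dt| ≤ ε N`.

Disproof used: `Cruxes/UniformAbelianRegularity/Disproof.lean` (cdisprove cycle 1, 08:33Z, unchanged at 15:05Z): no stub killed;
§B two-scale family / §A.2 harmonic corner = what K1, TAILSRATE, TGK3, EARLY3 exclude (`lam, β > 0` act there); landed
`Negative/HarmonicCornerTwoScale` (p148790).  No `-- Targets` section yet; targets offered: the six stubs below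
(cheapest suspects: TAILSRATE/TGK3's power RATE `N^{1−δ}` and EARLY3's ξ-uniformity).
-/

noncomputable section

namespace Summit.AtomisticToContinuum.FouriersLaw.Cruxes.UniformAbelianRegularity.ZeroMeanDyadicSplice

open MeasureTheory Set Filter Topology

/-! ## Registered open stubs (`sorry` only here; signatures self-contained, byte-identical with the registered one-line text) -/

/-- **stub `stub_contactSplice` (M1 = K3 ∧ K2 w.r.t. the regular pair; physical, XL; OPEN).**  For `pinnedChain ω₂ lam β γ`
(all `> 0`), `T > 0` and EVERY regular pair `(μT, D)` (DLR Gibbs at `T`, shift-invariant, superstable, carrier in `bmGood`,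
`μT`-preserving, absolutely convergent summed current correlations): an `N`-free measurable, locally integrable, Cesàro-small
end correction `E`, a slope `c₀ > 0`, `K ≥ 0`, `N₁` with the linear-horizon `L¹` splice
`∫_{(0,c₀N]} |c_N(t) − (N−1)·D.currentCorrelation μT t − E(t)| dt ≤ K` (`N ≥ N₁`).  Formalised reduction: `Lines/Sketch_aux_M1_of_linear_cones.lean`. -/
theorem stub_contactSplice :
    ∀ ω₂ lam β γ : ℝ, 0 < ω₂ → 0 < lam → 0 < β → 0 < γ → ∀ T : ℝ, 0 < T → ∀ (μT : MeasureTheory.Measure Literature.MathematicalPhysics.KineticTheory.HeatConduction.ChainConfig) (D : Literature.MathematicalPhysics.KineticTheory.HeatConduction.InfiniteChainDynamics (Literature.MathematicalPhysics.KineticTheory.HeatConduction.pinnedChain ω₂ lam β γ)), (Literature.MathematicalPhysics.KineticTheory.HeatConduction.pinnedChain ω₂ lam β γ).IsChainGibbsMeasure T μT → Literature.MathematicalPhysics.KineticTheory.HeatConduction.IsShiftInvariant μT → (Literature.MathematicalPhysics.KineticTheory.HeatConduction.pinnedChain ω₂ lam β γ).HasSuperstabilityEstimate μT → D.carrier ⊆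 (Literature.MathematicalPhysics.KineticTheory.HeatConduction.pinnedChain ω₂ lam β γ).bmGood → D.PreservesMeasure μT → (∀ t : ℝ, D.HasAbsConvergentCorrelation μT t) → ∃ (E : ℝ → ℝ) (c₀ K : ℝ) (N₁ : ℕ), 0 < c₀ ∧ 0 ≤ K ∧ Measurable E ∧ (∀ τ : ℝ, 0 < τ → MeasureTheory.IntegrableOn E (Set.Ioc 0 τ)) ∧ (∀ ε : ℝ, 0 < ε → ∃ τ₀ : ℝ, 0 < τ₀ ∧ ∀ τ : ℝ, τ₀ ≤ τ → ∫ t in Set.Ioc 0 τ, |E t| ≤ ε * τ) ∧ (∀ N : ℕ, N₁ ≤ N → let J : Literature.MathematicalPhysics.KineticTheory.HeatConduction.PhaseSpace N → ℝ := fun z => ∑ i : Fin N, (Literature.MathematicalPhysics.KineticTheory.HeatConduction.pinnedChain ω₂ lam β γ).bondCurrent N i z; ∫ t in Set.Ioc 0 (c₀ * N), |(∫ z, J z * (∫ y, J y ∂((Literature.MathematicalPhysics.KineticTheory.HeatConduction.pinnedChain ω₂ lam β γ).transitionKernel N T T t.toNNReal z)) ∂((Literature.MathematicalPhysics.KineticTheory.HeatConduction.pinnedChain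 ω₂ lam β γ).gibbsMeasure N T)) - ((N:ℝ) - 1) * D.currentCorrelation μT t - E t| ≤ K) := by
  sorry

/-- **stub `stub_bulkAbelRegularPair` (M2; physical, XL; OPEN — blocked on EXISTING items).**  For every regular pair `(μT, D)` as above
the ABEL MEANS of the bulk current correlation converge: `∃ Λ, ∫₀^∞ e^{−νt} D.currentCorrelation μT t dt → Λ` (`ν ↓ 0`).  (R)-necessary
(p164462 `bulkAbel_of_regularity`); supplied by `WindowDecomposition ∧ NoDrudeWeight` (stmt-14011 ∧ stmt-14012; landed glue
`stub_bulkAbelRegularPairOfWindow`, p166843) or by `AbelGreenKubo` (stmt-14010) ∧ SI (`stub_bulkAbelRegularPairOfAbelGreenKubo`). -/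
theorem stub_bulkAbelRegularPair :
    ∀ ω₂ lam β γ : ℝ, 0 < ω₂ → 0 < lam → 0 < β → 0 < γ → ∀ T : ℝ, 0 < T → ∀ (μT : MeasureTheory.Measure Literature.MathematicalPhysics.KineticTheory.HeatConduction.ChainConfig) (D : Literature.MathematicalPhysics.KineticTheory.HeatConduction.InfiniteChainDynamics (Literature.MathematicalPhysics.KineticTheory.HeatConduction.pinnedChain ω₂ lam β γ)), (Literature.MathematicalPhysics.KineticTheory.HeatConduction.pinnedChain ω₂ lam β γ).IsChainGibbsMeasure T μT → Literature.MathematicalPhysics.KineticTheory.HeatConduction.IsShiftInvariant μT → (Literature.MathematicalPhysics.KineticTheory.HeatConduction.pinnedChain ω₂ lam β γ).HasSuperstabilityEstimate μT → D.carrier ⊆ (Literature.MathematicalPhysics.KineticTheory.HeatConduction.pinnedChain ω₂ lam β γ).bmGood → D.PreservesMeasure μT → (∀ t : ℝ, D.HasAbsConvergentCorrelation μT t) → ∃ Λ : ℝ, Filter.Tendsto (fun ν : ℝ => ∫ t in Set.Ioi (0:ℝ), Real.exp (-(ν * t)) * D.currentCorrelation μT t) (nhdsWithin (0:ℝ) (Set.Ioi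 0)) (nhds Λ) := by
  sorry

/-- **stub `stub_postCrossingTails` (K1, `ε`-form; physical, XL — the residual; OPEN, lead-held).** For `pinnedChain ω₂ lam β γ` (all `> 0`), `T > 0`,
every slope `c₀ > 0` and `ε > 0` there is `N₀` such that for all `N ≥ N₀` and all `ξ ≥ c₀ N` the SIGNED Green–Kubo tail obeys
`|∫_{(ξ,∞)} c_N(s) ds| ≤ ε N`.  Implied by ST (p153215), by TGK3 (p165030), by TAILSRATE; false at the harmonic corner. -/
theorem stub_postCrossingTails :
    ∀ ω₂ lam β γ : ℝ, 0 < ω₂ → 0 < lam → 0 < β → 0 < γ → ∀ T : ℝ, 0 < T → ∀ c₀ : ℝ, 0 < c₀ → ∀ ε : ℝ, 0 < ε →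
      ∃ N₀ : ℕ, ∀ N : ℕ, N₀ ≤ N → ∀ ξ : ℝ, c₀ * N ≤ ξ → let J : Literature.MathematicalPhysics.KineticTheory.HeatConduction.PhaseSpace N → ℝ := fun z => ∑ i : Fin N, (Literature.MathematicalPhysics.KineticTheory.HeatConduction.pinnedChain ω₂ lam β γ).bondCurrent N i z; |∫ s in Set.Ioi ξ, ∫ z, J z * (∫ y, J y ∂((Literature.MathematicalPhysics.KineticTheory.HeatConduction.pinnedChain ω₂ lam β γ).transitionKernel N T T s.toNNReal z)) ∂((Literature.MathematicalPhysics.KineticTheory.HeatConduction.pinnedChain ω₂ lam β γ).gibbsMeasure N T)| ≤ ε * N := by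
  sorry

/-- **stub `stub_truncatedGKQuasiAdditive` (TGK3; physical, XL; OPEN — ν-free single stub of composition B).**
`∃ K, δ ∈ (0,1), N₁ ∀ N ≥ 2N₁ ∀ ξ ≥ 0, |∫_{(ξ,∞)} (c_N − c_{⌊N/2⌋} − c_{N−⌊N/2⌋})| ≤ K N^{1−δ}`.  False at the harmonic corner. -/
theorem stub_truncatedGKQuasiAdditive :
    ∀ ω₂ lam β γ : ℝ, 0 < ω₂ → 0 < lam → 0 < β → 0 < γ → ∀ T : ℝ, 0 < T → ∃ (K δ : ℝ) (N₁ : ℕ), 0 < δ ∧ δ < 1 ∧ ∀ N : ℕ, 2 * N₁ ≤ N → ∀ ξ : ℝ, 0 ≤ ξ → let c : ℕ → ℝ → ℝ := fun M t => ∫ z, (∑ i : Fin M, (Literature.MathematicalPhysics.KineticTheory.HeatConduction.pinnedChain ω₂ lam β γ).bondCurrent M i z) * (∫ y, (∑ i : Fin M, (Literature.MathematicalPhysics.KineticTheory.HeatConduction.pinnedChain ω₂ lam β γ).bondCurrent M i y) ∂((Literature.MathematicalPhysics.KineticTheory.HeatConduction.pinnedChain ω₂ lam β γ).transitionKernel M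 T T t.toNNReal z)) ∂((Literature.MathematicalPhysics.KineticTheory.HeatConduction.pinnedChain ω₂ lam β γ).gibbsMeasure M T); |∫ s in Set.Ioi ξ, (c N s - c (N / 2) s - c (N - N / 2) s)| ≤ K * (N:ℝ) ^ (1 - δ) := by
  sorry

/-- **stub `stub_early3Cancellation` (EARLY3; physical, XL; OPEN — pre-crossing face of TGK3).**  `∃ c₀ > 0, K, δ ∈ (0,1), N₁ ∀ N ≥ 2N₁
∀ ξ ∈ [0, c₀⌊N/2⌋], |∫_{(ξ, c₀⌊N/2⌋]} (c_N − c_{⌊N/2⌋} − c_{N−⌊N/2⌋})| ≤ K N^{1−δ}` — signed, uniform in the lower endpoint: before the common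
crossing time the extensive bulk parts cancel exactly, leaving one junction correction minus two contact corrections, `N`-free, with
bounded running integrals.  Needs a two-dynamics comparison of the open `N`-chain with its two open halves up to times `≍ N`. -/
theorem stub_early3Cancellation :
    ∀ ω₂ lam β γ : ℝ, 0 < ω₂ → 0 < lam → 0 < β → 0 < γ → ∀ T : ℝ, 0 < T → ∃ (c₀ K δ : ℝ) (N₁ : ℕ), 0 < c₀ ∧ 0 < δ ∧ δ < 1 ∧ ∀ N : ℕ, 2 * N₁ ≤ N → ∀ ξ : ℝ, 0 ≤ ξ → ξ ≤ c₀ * ((N / 2 : ℕ) : ℝ) → let c : ℕ → ℝ → ℝ := fun M t => ∫ z, (∑ i : Fin M, (Literature.MathematicalPhysics.KineticTheory.HeatConduction.pinnedChain ω₂ lam β γ).bondCurrent M i z) * (∫ y, (∑ i : Fin M, (Literature.MathematicalPhysics.KineticTheory.HeatConduction.pinnedChain ω₂ lam β γ).bondCurrent M i y) ∂((Literature.MathematicalPhysics.KineticTheory.HeatConduction.pinnedChain ω₂ lam β γ).transitionKernel M T T t.toNNReal z)) ∂((Literature.MathematicalPhysics.KineticTheory.HeatConduction.pinnedChain ω₂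 lam β γ).gibbsMeasure M T); |∫ s in Set.Ioc ξ (c₀ * ((N / 2 : ℕ) : ℝ)), (c N s - c (N / 2) s - c (N - N / 2) s)| ≤ K * (N:ℝ) ^ (1 - δ) := by
  sorry

/-- **stub `stub_postCrossingTailsRate` (TAILSRATE = K1 with a power rate, every slope; physical, XL; OPEN — post-crossing face of TGK3).**
`∀ c₀ > 0 ∃ K, δ ∈ (0,1), N₀ ∀ N ≥ N₀ ∀ ξ ≥ c₀N, |∫_{(ξ,∞)} c_N| ≤ K N^{1−δ}` (fluctuating hydrodynamics: `δ = 1/2`).  False at the harmonic corner. -/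
theorem stub_postCrossingTailsRate :
    ∀ ω₂ lam β γ : ℝ, 0 < ω₂ → 0 < lam → 0 < β → 0 < γ → ∀ T : ℝ, 0 < T → ∀ c₀ : ℝ, 0 < c₀ → ∃ (K δ : ℝ) (N₀ : ℕ), 0 < δ ∧ δ < 1 ∧ ∀ N : ℕ, N₀ ≤ N → ∀ ξ : ℝ, c₀ * N ≤ ξ → let c : ℕ → ℝ → ℝ := fun M t => ∫ z, (∑ i : Fin M, (Literature.MathematicalPhysics.KineticTheory.HeatConduction.pinnedChain ω₂ lam β γ).bondCurrent M i z) * (∫ y, (∑ i : Fin M, (Literature.MathematicalPhysics.KineticTheory.HeatConduction.pinnedChain ω₂ lam β γ).bondCurrent M i y) ∂((Literature.MathematicalPhysics.KineticTheory.HeatConduction.pinnedChain ω₂ lam β γ).transitionKernel M T T t.toNNReal z)) ∂((Literature.MathematicalPhysics.KineticTheory.HeatConduction.pinnedChain ω₂ lam β γ).gibbsMeasure M T); |∫ s in Set.Ioi ξ, c N s| ≤ K * (N:ℝ) ^ (1 - δ) := by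
  sorry

/-! ## The crux BY NAME -/

/-- **Composition A — the crux BY NAME** from M1 ∧ M2 ∧ K1 (glues p164462, p163652). -/
theorem UniformAbelianRegularity_skeleton :
    _root_.Summit.AtomisticToContinuum.FouriersLaw.Theses.StaticAbelianSqueeze.UniformAbelianRegularity :=
  Summit.AtomisticToContinuum.FouriersLaw.Theorems.UniformAbelianRegularity.AbelSummableSplice.stub_regularityOfAbelSummableSpliceAndTails
    (Summit.AtomisticToContinuum.FouriersLaw.Theorems.UniformAbelianRegularity.ZeroMeanDyadicSplice.stub_abelSummableSpliceOfContactSpliceOfBulkAbel stub_contactSplice stub_bulkAbelRegularPair)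
    stub_postCrossingTails

/-- **Composition A′ — the crux from M1 ∧ K1 CONDITIONALLY on the existing items `WindowDecomposition` (stmt-14011) and
`NoDrudeWeight` (stmt-14012)** of route LatticeLandauDamping (glue p166843; no witness seam).  Recorded as a conditional theorem:
the two items are not stubs of this crux. -/
theorem UniformAbelianRegularity_of_window
    (hWD : Summit.AtomisticToContinuum.FouriersLaw.Theses.LatticeLandauDamping.WindowDecomposition)
    (hND : Summit.AtomisticToContinuum.FouriersLaw.Theses.LatticeLandauDamping.NoDrudeWeight) :
    _root_.Summit.AtomisticToContinuum.FouriersLaw.Theses.StaticAbelianSqueeze.UniformAbelianRegularity :=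
  Summit.AtomisticToContinuum.FouriersLaw.Theorems.UniformAbelianRegularity.AbelSummableSplice.stub_regularityOfAbelSummableSpliceAndTails
    (Summit.AtomisticToContinuum.FouriersLaw.Theorems.UniformAbelianRegularity.ZeroMeanDyadicSplice.stub_abelSummableSpliceOfContactSpliceOfBulkAbel stub_contactSplice
      (Summit.AtomisticToContinuum.FouriersLaw.Theorems.UniformAbelianRegularity.ZeroMeanDyadicSplice.stub_bulkAbelRegularPairOfWindow hWD hND))
    stub_postCrossingTails

/-- **Composition B — the crux BY NAME** from TGK3 alone (glues p164485, p163567; fixed-`N` regularity p163862). -/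
theorem UniformAbelianRegularity_skeleton_qa :
    _root_.Summit.AtomisticToContinuum.FouriersLaw.Theses.StaticAbelianSqueeze.UniformAbelianRegularity :=
  Summit.AtomisticToContinuum.FouriersLaw.Theorems.UniformAbelianRegularity.ZeroMeanDyadicSplice.stub_regularityOfQuasiAdditivity
    (Summit.AtomisticToContinuum.FouriersLaw.Theorems.UniformAbelianRegularity.ZeroMeanDyadicSplice.stub_abelDeficitQuasiAdditiveOfTruncatedGK stub_truncatedGKQuasiAdditive)
    Summit.AtomisticToContinuum.FouriersLaw.Theorems.UniformAbelianRegularity.ZeroMeanDyadicSplice.stub_fixedNAbelRegularity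

/-- **Composition B′ — the crux BY NAME** from EARLY3 ∧ TAILSRATE (glue p166874 → composition B). -/
theorem UniformAbelianRegularity_skeleton_split :
    _root_.Summit.AtomisticToContinuum.FouriersLaw.Theses.StaticAbelianSqueeze.UniformAbelianRegularity :=
  Summit.AtomisticToContinuum.FouriersLaw.Theorems.UniformAbelianRegularity.ZeroMeanDyadicSplice.stub_regularityOfQuasiAdditivity
    (Summit.AtomisticToContinuum.FouriersLaw.Theorems.UniformAbelianRegularity.ZeroMeanDyadicSplice.stub_abelDeficitQuasiAdditiveOfTruncatedGK
      (Summit.AtomisticToContinuum.FouriersLaw.Theorems.UniformAbelianRegularity.ZeroMeanDyadicSplice.stub_truncatedGKQuasiAdditiveOfEarly3OfTailsRate stub_early3Cancellation stub_postCrossingTailsRate))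
    Summit.AtomisticToContinuum.FouriersLaw.Theorems.UniformAbelianRegularity.ZeroMeanDyadicSplice.stub_fixedNAbelRegularity

/-- K1 is below TGK3 (p165030): composition B's single stub also discharges composition A's tail stub. -/
theorem postCrossingTails_of_skeleton_qa :
    ∀ ω₂ lam β γ : ℝ, 0 < ω₂ → 0 < lam → 0 < β → 0 < γ → ∀ T : ℝ, 0 < T → ∀ c₀ : ℝ, 0 < c₀ → ∀ ε : ℝ, 0 < ε →
      ∃ N₀ : ℕ, ∀ N : ℕ, N₀ ≤ N → ∀ ξ : ℝ, c₀ * N ≤ ξ → let J : Literature.MathematicalPhysics.KineticTheory.HeatConduction.PhaseSpace N → ℝ := fun z => ∑ i : Fin N, (Literature.MathematicalPhysics.KineticTheory.HeatConduction.pinnedChain ω₂ lam β γ).bondCurrent N i z; |∫ s in Set.Ioi ξ, ∫ z, J z * (∫ y, J y ∂((Literature.MathematicalPhysics.KineticTheory.HeatConduction.pinnedChain ω₂ lam β γ).transitionKernel N T T s.toNNReal z)) ∂((Literature.MathematicalPhysics.KineticTheory.HeatConduction.pinnedChain ω₂ lam β γ).gibbsMeasure N T)| ≤ ε * N :=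
  Summit.AtomisticToContinuum.FouriersLaw.Theorems.UniformAbelianRegularity.ZeroMeanDyadicSplice.stub_postCrossingTailsOfTruncatedGK stub_truncatedGKQuasiAdditive

/-- The same term closes the `EmbeddedDrudeMourre` copy (and, verbatim, the three split copies). -/
theorem UniformAbelianRegularity_skeleton' :
    _root_.Summit.AtomisticToContinuum.FouriersLaw.Theses.EmbeddedDrudeMourre.UniformAbelianRegularity :=
  Summit.AtomisticToContinuum.FouriersLaw.Theorems.UniformAbelianRegularity.ZeroMeanDyadicSplice.stub_regularityOfQuasiAdditivity
    (Summit.AtomisticToContinuum.FouriersLaw.Theorems.UniformAbelianRegularity.ZeroMeanDyadicSplice.stub_abelDeficitQuasiAdditiveOfTruncatedGK stub_truncatedGKQuasiAdditive)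
    Summit.AtomisticToContinuum.FouriersLaw.Theorems.UniformAbelianRegularity.ZeroMeanDyadicSplice.stub_fixedNAbelRegularity

end Summit.AtomisticToContinuum.FouriersLaw.Cruxes.UniformAbelianRegularity.ZeroMeanDyadicSplice

end
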